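import Summits.QuantumAdvantage.QuantumAdvantage.Theorems.CharDialFutureRead
import Summits.QuantumAdvantage.QuantumAdvantage.Theorems.CharDialAdaptiveCounterSubcube
import HarnessLib
import Summits.QuantumAdvantage.AdviceFreeQNC0.SumCodeDegreeZero
import Summits.QuantumAdvantage.AdviceFreeQNC0.WindowCharacters

/-!
# Near one-reads RE-TIMED: one-read counter sources on SPARSE subcubes are E4 instances (decomp-qadv lens-6 g14, tree part 28A)

Part 25 (`CharDialFutureRead`) reduced a one-read counter source `(A, B, rp, φ)` — cut `g` answers
`A_g(φ_g(v)) ⊕ [rp g = some j]·(v_j ∧ B_g(j, φ_g(v)))`, `φ_g` a counter statistic mod `p` — on a subcube `{u_W = b_W}` whose free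
reads are all PROMISED BEFORE THE FREE SEGMENT to the scheduled counter process of part 24.  Here the complementary regime:
every cut `g` reading a FREE position `t` has the SEGMENT strictly between the cut and the bit FROZEN (`seg g t ⊆ W`: lookahead
`[g, t)`, memory `(t, g)`) — no condition on how many cuts read `t`, nor on other free bits outside the segment.  Then the
counter and the label seen by `g` are those of step `t` up to FROZEN OFFSETS (`ctrN_rdr`, `labN_rdr`: `ctrOff`, `labOff`), so the
bit-dependent fire `[u_t ∧ B_g]·e(ℓ_g)` can be RE-TIMED to the consumption step `t` of its bit, where it is the branch-1 fire
`[B_g-table at b_t + ctrOff]·e(a_t + labOff)` — an ADMISSIBLE fibre-dependent label-to-register map (a shifted optional tog); all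
readers of `t` together fire `⊕_d [N_d odd]·e(a_t + d)` (`readV`, three residue classes of label offsets), still admissible.
With the pure counter fires `[yC-table]·e(a_t)` on both branches this is an instance `(vS, vfS)` of the E4 kernel of part 27
(`adaptiveSubcube_sharp`): `regA = regN(yC) ⊕ cumR` (`regA_vS`), `ev (cumR n) s` = parity of the winning free-read cuts
(`ev_cumR` + the fibration `card_yF_eq_sum`), hence LOSE ⟺ the E4 process ends in `L_{(n−c,0)}` (`lose_iff_memA`) and
**`winSubcubeNear_le`**: at most `(2/3 + 5p·√(12p/(n − |W| + 1)))·2ⁿ` merged inputs win (`3 ∤ p`).  §3 specialises to prefix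
one-read `JLinData` (`nearReadSubcube_le`); part 28 (`CharDialOneReadClose`) adds the far/near trichotomy and closes the one-read
prefix face.  Kernel-closed; imports parts 25 and 27.
-/

namespace Summit.QuantumAdvantage.AdviceFreeQNC0

open Finset AffBells22

namespace CounterLaw

/-! ## §1 Optional togs and parities -/

/-- the optional tog `[σ]·e(c)`. -/
def otog (σ : Bool) (c : ZMod 3) : Bool × Bool := if σ = true then tog c (false, false) else (false, false)

/-- CharDialNearReadSubcube helper `ev_otog`. -/
theorem ev_otog (σ : Bool) (c s : ZMod 3) : ev (otog σ c) s = (σ && decide (s ≠ c)) := by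
  unfold otog
  cases σ
  · simp [ev_zero]
  · simp [ev_tog_zero]

/-- CharDialNearReadSubcube helper `otog_false`. -/
theorem otog_false (c : ZMod 3) : otog false c = (false, false) := by simp [otog]

/-- CharDialNearReadSubcube helper `otog_true`. -/
theorem otog_true (c : ZMod 3) : otog true c = tog c (false, false) := by simp [otog]

/-- shifted optional togs are admissible … -/
theorem otog_mem_Adm (σ : Bool) (d : ZMod 3) : (fun a => otog σ (a + d)) ∈ Adm := tog_mem_Adm σ d

/-- … in particular unshifted ones. -/
theorem otog_mem_Adm' (σ : Bool) : (fun a => otog σ a) ∈ Adm := by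
  have e : (fun a => otog σ a) = fun a => if σ = true then tog (a + 0) (false, false) else (false, false) :=
    funext fun a => by simp only [otog, add_zero]
  rw [e]
  exact tog_mem_Adm σ 0

/-- a tog is the `⊕` of the register with `e(a)`. -/
theorem tog_eq_bx_tog (a : ZMod 3) (r : Bool × Bool) : tog a r = bx r (tog a (false, false)) := by
  revert a r; decide

/-- CharDialNearReadSubcube helper `bx_zero_left`. -/
theorem bx_zero_left (s : Bool × Bool) : bx (false, false) s = s := by
  rw [bx_comm, bx_zero]

/-- the four-term exchange `(R ⊕ C) ⊕ (E ⊕ V) = (R ⊕ E) ⊕ (C ⊕ V)`. -/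
theorem bx_bx_bx_comm (R C E V : Bool × Bool) : bx (bx R C) (bx E V) = bx (bx R E) (bx C V) := by
  rw [bx_assoc, bx_assoc, ← bx_assoc C E V, bx_comm C E, bx_assoc E C V]

/-- parity of an optional summand. -/
theorem decide_ite_mod_two (c : Prop) [Decidable c] (x : ℕ) :
    decide ((if c then x else 0) % 2 = 1) = (decide c && decide (x % 2 = 1)) := by
  by_cases hc : c
  · simp [hc]
  · simp [hc]

end CounterLaw

namespace JLinPeel

open CounterLaw

/-! ## §2 Segments, frozen offsets, and the E4 data of a one-read counter source on a subcube -/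

section Near

variable {p n : ℕ} (A : Fin (n + 1) → ZMod p → Bool) (B : Fin (n + 1) → Fin n → ZMod p → Bool)
  (rp : Fin (n + 1) → Option (Fin n)) (φ : Fin (n + 1) → (Fin n → Bool) → ZMod p)
  (W : Finset (Fin n)) (b : Fin n → Bool)

/-- the SEGMENT strictly between cut `g` and position `t`: `[g, t)` for a lookahead read (`g ≤ t`), `(t, g)` for a memory
read (`t < g`). -/
def seg (g : Fin (n + 1)) (t : Fin n) : Finset (Fin n) :=
  if g.val ≤ t.val then univ.filter fun i : Fin n => g.val ≤ i.val ∧ i.val < t.val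
  else univ.filter fun i : Fin n => t.val < i.val ∧ i.val < g.val

/-- the number of frozen ones in the segment. -/
def segOnes (g : Fin (n + 1)) (t : Fin n) : ℕ := ((seg g t).filter fun i => b i = true).card

/-- the COUNTER OFFSET: counter seen by cut `g` = counter at step `t` + `ctrOff` (on inputs with `u_t = 1` for memory reads). -/
def ctrOff (p : ℕ) (g : Fin (n + 1)) (t : Fin n) : ZMod p :=
  if g.val ≤ t.val then -((segOnes b g t : ℕ) : ZMod p) else ((segOnes b g t + 1 : ℕ) : ZMod p)

/-- the LABEL OFFSET: label of cut `g` = label at step `t` + `labOff` (same proviso). -/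
def labOff (g : Fin (n + 1)) (t : Fin n) : ZMod 3 :=
  if g.val ≤ t.val then -((t.val - g.val + segOnes b g t : ℕ) : ZMod 3)
  else ((g.val - t.val + 1 + segOnes b g t : ℕ) : ZMod 3)

/-- lookahead read with frozen segment: `W_{<t} = W_{<g} + segOnes`. -/
theorem wtPrefix_look {g : Fin (n + 1)} {t : Fin n} (hgt : g.val ≤ t.val) (hseg : ∀ i ∈ seg g t, i ∈ W)
    (u : Fin n → Bool) :
    wtPrefix (subcubeMerge W b u) t.val = wtPrefix (subcubeMerge W b u) g.val + segOnes b g t := by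
  rw [wtPrefix_eq_add_midCount _ hgt, segOnes, seg, if_pos hgt, filter_filter]
  congr 2; ext i; simp only [mem_filter, mem_univ, true_and]
  have hW : g.val ≤ i.val ∧ i.val < t.val → i ∈ W := fun h =>
    hseg i (by rw [seg, if_pos hgt]; exact mem_filter.2 ⟨mem_univ _, h⟩)
  constructor
  · rintro ⟨hg, hi, hu⟩
    rw [merge_apply_frozen W b u (hW ⟨hg, hi⟩)] at hu
    exact ⟨⟨hg, hi⟩, hu⟩
  · rintro ⟨h, hb⟩
    exact ⟨h.1, h.2, by rw [merge_apply_frozen W b u (hW h)]; exact hb⟩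

/-- memory read with frozen segment, on inputs with `u_t = 1`: `W_{<g} = W_{<t} + 1 + segOnes`. -/
theorem wtPrefix_memo {g : Fin (n + 1)} {t : Fin n} (hgt : t.val < g.val) (hseg : ∀ i ∈ seg g t, i ∈ W)
    (u : Fin n → Bool) (hut : subcubeMerge W b u t = true) :
    wtPrefix (subcubeMerge W b u) g.val = wtPrefix (subcubeMerge W b u) t.val + 1 + segOnes b g t := by
  have h1 := wtPrefix_succ_eq (subcubeMerge W b u) t
  rw [hut, Bool.toNat_true] at h1
  rw [wtPrefix_eq_add_midCount _ (Nat.succ_le_of_lt hgt), h1, segOnes, seg, if_neg (not_le.2 hgt), filter_filter]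
  congr 2; ext i; simp only [mem_filter, mem_univ, true_and]
  have hW : t.val < i.val ∧ i.val < g.val → i ∈ W := fun h =>
    hseg i (by rw [seg, if_neg (not_le.2 hgt)]; exact mem_filter.2 ⟨mem_univ _, h⟩)
  constructor
  · rintro ⟨hg, hi, hu⟩
    have h' : t.val < i.val ∧ i.val < g.val := ⟨Nat.lt_of_succ_le hg, hi⟩
    rw [merge_apply_frozen W b u (hW h')] at hu
    exact ⟨h', hu⟩
  · rintro ⟨h, hb⟩
    exact ⟨Nat.succ_le_of_lt h.1, h.2, by rw [merge_apply_frozen W b u (hW h)]; exact hb⟩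

/-- **the counter seen by a reading cut with frozen segment = the counter at the consumption step + a frozen offset.** -/
theorem ctrN_rdr {g : Fin (n + 1)} {t : Fin n} (hseg : ∀ i ∈ seg g t, i ∈ W) (u : Fin n → Bool)
    (hut : subcubeMerge W b u t = true) :
    ctrN p (subcubeMerge W b u) g.val = ctrN p (subcubeMerge W b u) t.val + ctrOff b p g t := by
  unfold ctrN
  by_cases hgt : g.val ≤ t.val
  · rw [ctrOff, if_pos hgt, wtPrefix_look W b hgt hseg u]; push_cast; ring
  · rw [ctrOff, if_neg hgt, wtPrefix_memo W b (not_le.1 hgt) hseg u hut]; push_cast; ring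

/-- **… and the same for the label.** -/
theorem labN_rdr {g : Fin (n + 1)} {t : Fin n} (hseg : ∀ i ∈ seg g t, i ∈ W) (u : Fin n → Bool)
    (hut : subcubeMerge W b u t = true) :
    labN (subcubeMerge W b u) g.val = labN (subcubeMerge W b u) t.val + labOff b g t := by
  unfold labN
  by_cases hgt : g.val ≤ t.val
  · rw [labOff, if_pos hgt, wtPrefix_look W b hgt hseg u]
    obtain ⟨k, hk⟩ : ∃ k, t.val = g.val + k := ⟨t.val - g.val, by omega⟩
    rw [hk, Nat.add_sub_cancel_left]; push_cast; ring
  · rw [labOff, if_neg hgt, wtPrefix_memo W b (not_le.1 hgt) hseg u hut]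
    obtain ⟨k, hk⟩ : ∃ k, g.val = t.val + k := ⟨g.val - t.val, by omega⟩
    rw [hk, Nat.add_sub_cancel_left]; push_cast; ring

/-- the `B`-FLAG strategy of the source (a counter strategy). -/
def yB : Fin (n + 1) → (Fin n → Bool) → Bool := fun g v =>
  match rp g with
  | some j => B g j (φ g v)
  | none => false

/-- CharDialNearReadSubcube helper `yB_counter`. -/
theorem yB_counter
    (hφ : ∀ g : Fin (n + 1), ∀ u v : Fin n → Bool, wtPrefix u g.val % p = wtPrefix v g.val % p → φ g u = φ g v)
    (g : Fin (n + 1)) (u v : Fin n → Bool) (huv : wtPrefix u g.val % p = wtPrefix v g.val % p) :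
    yB B rp φ g u = yB B rp φ g v := by
  unfold yB
  rw [hφ g u v huv]

/-- the flag strategy through its table. -/
theorem tabN_yB
    (hφ : ∀ g : Fin (n + 1), ∀ u v : Fin n → Bool, wtPrefix u g.val % p = wtPrefix v g.val % p → φ g u = φ g v)
    (g : Fin (n + 1)) (u : Fin n → Bool) :
    tabN p (yB B rp φ) g.val (ctrN p u g.val) = yB B rp φ g u := by
  unfold tabN ctrN
  rw [dif_pos g.isLt]
  exact fTab_spec p _ (yB_counter B rp φ hφ) g u

/-- the number of cuts reading position `t` whose flag table fires at counter `bb + ctrOff` and whose label offset is `d`. -/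
noncomputable def Nrd (t : Fin n) (bb : ZMod p) (d : ZMod 3) : ℕ :=
  (univ.filter fun g : Fin (n + 1) =>
    rp g = some t ∧ tabN p (yB B rp φ) g.val (bb + ctrOff b p g t) = true ∧ labOff b g t = d).card

/-- … and the number of those whose re-timed label `a + labOff` differs from `s`. -/
noncomputable def Crd (t : Fin n) (bb : ZMod p) (a s : ZMod 3) : ℕ :=
  (univ.filter fun g : Fin (n + 1) =>
    rp g = some t ∧ tabN p (yB B rp φ) g.val (bb + ctrOff b p g t) = true ∧ a + labOff b g t ≠ s).card

/-- the three residue classes of label offsets. -/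
theorem Crd_three (t : Fin n) (bb : ZMod p) (a s : ZMod 3) :
    Crd B rp φ b t bb a s
      = (if a + 0 ≠ s then Nrd B rp φ b t bb 0 else 0) + (if a + 1 ≠ s then Nrd B rp φ b t bb 1 else 0)
        + (if a + 2 ≠ s then Nrd B rp φ b t bb 2 else 0) := by
  classical
  unfold Crd
  set S := univ.filter fun g : Fin (n + 1) =>
    rp g = some t ∧ tabN p (yB B rp φ) g.val (bb + ctrOff b p g t) = true ∧ a + labOff b g t ≠ s with hS
  have hfib : ∀ d : ZMod 3, (S.filter fun g => labOff b g t = d).card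
      = if a + d ≠ s then Nrd B rp φ b t bb d else 0 := by
    intro d
    by_cases hd : a + d ≠ s
    · rw [if_pos hd, Nrd, hS, filter_filter]
      congr 1; ext g; simp only [mem_filter, mem_univ, true_and]
      constructor
      · rintro ⟨⟨h1, h2, _⟩, h4⟩; exact ⟨h1, h2, h4⟩
      · rintro ⟨h1, h2, h4⟩; exact ⟨⟨h1, h2, by rw [h4]; exact hd⟩, h4⟩
    · rw [if_neg hd, card_eq_zero, filter_eq_empty_iff]
      intro g hg h4
      rw [hS, mem_filter] at hg
      exact hd (by rw [← h4]; exact hg.2.2.2)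
  rw [card_eq_sum_card_fiberwise (f := fun g => labOff b g t) (t := univ) (fun g _ => mem_univ _)]
  have hu : (univ : Finset (ZMod 3)) = {0, 1, 2} := by decide
  rw [hu, sum_insert (by decide), sum_insert (by decide), sum_singleton, hfib, hfib, hfib]
  ring

/-- the RE-TIMED READ FIRE at step `t` on branch `β`: at a free step on branch 1, all readers of `t` fire
`⊕_d [Nrd t bb d odd]·e(a + d)`; nothing otherwise. -/
noncomputable def readV (t : ℕ) (β : Bool) (bb : ZMod p) (a : ZMod 3) : Bool × Bool :=
  if h : t < n then
    if (⟨t, h⟩ : Fin n) ∉ W ∧ β = true then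
      bx (bx (otog (decide (Nrd B rp φ b ⟨t, h⟩ bb 0 % 2 = 1)) (a + 0))
            (otog (decide (Nrd B rp φ b ⟨t, h⟩ bb 1 % 2 = 1)) (a + 1)))
        (otog (decide (Nrd B rp φ b ⟨t, h⟩ bb 2 % 2 = 1)) (a + 2))
    else (false, false)
  else (false, false)

/-- the PURE COUNTER FIRE of cut `t`: the table of the counter part `yC` of part 25. -/
noncomputable def pureV (t : ℕ) (bb : ZMod p) (a : ZMod 3) : Bool × Bool := otog (tabN p (yC A B rp φ W b) t bb) a

/-- **the E4 data of the source on the subcube**: pure fire ⊕ re-timed read fire … -/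
noncomputable def vS (t : ℕ) (β : Bool) (bb : ZMod p) (a : ZMod 3) : Bool × Bool :=
  bx (pureV A B rp φ W b t bb a) (readV B rp φ W b t β bb a)

/-- … and the final fire = the pure fire of cut `n`. -/
noncomputable def vfS (bb : ZMod p) (a : ZMod 3) : Bool × Bool := pureV A B rp φ W b n bb a

/-- the read fires are admissible … -/
theorem readV_mem_Adm (t : ℕ) (β : Bool) (bb : ZMod p) : readV B rp φ W b t β bb ∈ Adm := by
  by_cases h : t < n
  · by_cases h' : (⟨t, h⟩ : Fin n) ∉ W ∧ β = true
    · have e : readV B rp φ W b t β bb = fun a =>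
          bx (bx (otog (decide (Nrd B rp φ b ⟨t, h⟩ bb 0 % 2 = 1)) (a + 0))
                (otog (decide (Nrd B rp φ b ⟨t, h⟩ bb 1 % 2 = 1)) (a + 1)))
            (otog (decide (Nrd B rp φ b ⟨t, h⟩ bb 2 % 2 = 1)) (a + 2)) :=
        funext fun a => by simp only [readV, dif_pos h, if_pos h']
      rw [e]
      exact bx_mem_Adm (bx_mem_Adm (otog_mem_Adm _ _) (otog_mem_Adm _ _)) (otog_mem_Adm _ _)
    · have e : readV B rp φ W b t β bb = fun _ => (false, false) :=
        funext fun a => by simp only [readV, dif_pos h, if_neg h']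
      rw [e]; exact const_mem_Adm _
  · have e : readV B rp φ W b t β bb = fun _ => (false, false) :=
      funext fun a => by simp only [readV, dif_neg h]
    rw [e]; exact const_mem_Adm _

/-- … so are the pure fires … -/
theorem pureV_mem_Adm (t : ℕ) (bb : ZMod p) : pureV A B rp φ W b t bb ∈ Adm := otog_mem_Adm' _

/-- … hence the E4 data. -/
theorem vS_mem_Adm (t : ℕ) (β : Bool) (bb : ZMod p) : vS A B rp φ W b t β bb ∈ Adm :=
  bx_mem_Adm (pureV_mem_Adm A B rp φ W b t bb) (readV_mem_Adm B rp φ W b t β bb)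

/-- CharDialNearReadSubcube helper `vfS_mem_Adm`. -/
theorem vfS_mem_Adm (bb : ZMod p) : vfS A B rp φ W b bb ∈ Adm := pureV_mem_Adm A B rp φ W b n bb

/-- the accumulated re-timed read fires before step `t`. -/
noncomputable def cumR (u : Fin n → Bool) : ℕ → Bool × Bool
  | 0 => (false, false)
  | t + 1 => if h : t < n then bx (cumR u t) (readV B rp φ W b t (u ⟨t, h⟩) (ctrN p u t) (labN u t)) else cumR u t

/-- **the adaptive register = the counter register of `yC` ⊕ the accumulated read fires** (`t ≤ n`). -/
theorem regA_vS (u : Fin n → Bool) : ∀ t : ℕ, t ≤ n →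
    regA p (vS A B rp φ W b) u t = bx (regN p (yC A B rp φ W b) u t) (cumR B rp φ W b u t)
  | 0, _ => by simp [regA, regN, cumR]
  | t + 1, ht => by
    have h : t < n := Nat.lt_of_succ_le ht
    rw [regA, dif_pos h, regA_vS u t h.le, cumR, dif_pos h, regN, vS, pureV]
    have ef : firedN p (yC A B rp φ W b) u t = tabN p (yC A B rp φ W b) t (ctrN p u t) := rfl
    rw [ef]
    cases tabN p (yC A B rp φ W b) t (ctrN p u t)
    · rw [otog_false, bx_zero_left]
      simp only [Bool.false_eq_true, if_false]
      rw [bx_assoc]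
    · rw [otog_true, if_pos rfl, tog_eq_bx_tog (labN u t) (regN p _ u t), bx_bx_bx_comm]

/-- the final fired register = `regN(yC)` after cut `n` ⊕ the accumulated read fires. -/
theorem finalA_eq (u : Fin n → Bool) :
    (fireA p (vfS A B rp φ W b) (XA p (vS A B rp φ W b) u n)).1
      = bx (regN p (yC A B rp φ W b) u (n + 1)) (cumR B rp φ W b u n) := by
  rw [fireA_apply]
  show bx (regA p (vS A B rp φ W b) u n) (vfS A B rp φ W b (ctrN p u n) (labN u n)) = _
  rw [regA_vS A B rp φ W b u n le_rfl, regN, vfS, pureV]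
  have ef : firedN p (yC A B rp φ W b) u n = tabN p (yC A B rp φ W b) n (ctrN p u n) := rfl
  rw [ef]
  cases tabN p (yC A B rp φ W b) n (ctrN p u n)
  · rw [otog_false, bx_zero]
    simp only [Bool.false_eq_true, if_false]
  · rw [otog_true, if_pos rfl, tog_eq_bx_tog (labN u n) (regN p _ u n), bx_assoc, bx_assoc, bx_comm (cumR B rp φ W b u n)]

/-- the read fire at a free step on branch 1, evaluated: the parity of `Crd`. -/
theorem ev_readV_free (t : Fin n) (ht : t ∉ W) (bb : ZMod p) (a s : ZMod 3) :
    ev (readV B rp φ W b t.val true bb a) s = decide (Crd B rp φ b t bb a s % 2 = 1) := by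
  have e : readV B rp φ W b t.val true bb a
      = bx (bx (otog (decide (Nrd B rp φ b t bb 0 % 2 = 1)) (a + 0))
            (otog (decide (Nrd B rp φ b t bb 1 % 2 = 1)) (a + 1)))
        (otog (decide (Nrd B rp φ b t bb 2 % 2 = 1)) (a + 2)) := by
    unfold readV
    rw [dif_pos t.isLt, if_pos ⟨(by simpa using ht), rfl⟩]
  rw [e, ev_bx, ev_bx, ev_otog, ev_otog, ev_otog, Crd_three, SumCodeZero.decide_add_mod_two, SumCodeZero.decide_add_mod_two,
    decide_ite_mod_two, decide_ite_mod_two, decide_ite_mod_two]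
  have hc : ∀ (d : ZMod 3) (q : Bool), (decide (a + d ≠ s) && q) = (q && decide (s ≠ a + d)) := by
    intro d q
    rw [Bool.and_comm, decide_eq_decide.2 ne_comm]
  rw [hc, hc, hc]

/-- the read fire vanishes on branch 0 and at frozen steps. -/
theorem readV_eq_zero {t : ℕ} (h : t < n) {β : Bool} (hb : (⟨t, h⟩ : Fin n) ∈ W ∨ β = false) (bb : ZMod p)
    (a : ZMod 3) : readV B rp φ W b t β bb a = (false, false) := by
  unfold readV
  rw [dif_pos h, if_neg]
  rintro ⟨h1, h2⟩
  rcases hb with hb | hb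
  · exact h1 hb
  · rw [hb] at h2; exact Bool.false_ne_true h2

/-- the summands of the read-win count, indexed by `ℕ`. -/
noncomputable def crdN (u : Fin n → Bool) (i : ℕ) (s : ZMod 3) : ℕ :=
  if h : i < n then
    (if (⟨i, h⟩ : Fin n) ∉ W ∧ u ⟨i, h⟩ = true then Crd B rp φ b ⟨i, h⟩ (ctrN p u i) (labN u i) s else 0)
  else 0

/-- **the accumulated read fires, evaluated**: `ev (cumR u t) s` is the parity of `Σ_{i<t} crdN u i s`. -/
theorem ev_cumR (u : Fin n → Bool) (s : ZMod 3) : ∀ t : ℕ,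
    ev (cumR B rp φ W b u t) s = decide ((∑ i ∈ range t, crdN B rp φ W b u i s) % 2 = 1)
  | 0 => by simp [cumR, ev_zero]
  | t + 1 => by
    rw [sum_range_succ, SumCodeZero.decide_add_mod_two, ← ev_cumR u s t, cumR]
    by_cases h : t < n
    · rw [dif_pos h, ev_bx, crdN, dif_pos h]
      congr 1
      by_cases hc : (⟨t, h⟩ : Fin n) ∉ W ∧ u ⟨t, h⟩ = true
      · rw [if_pos hc, hc.2]
        exact ev_readV_free B rp φ W b ⟨t, h⟩ hc.1 _ _ s
      · have hb : (⟨t, h⟩ : Fin n) ∈ W ∨ u ⟨t, h⟩ = false := by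
          by_cases hw : (⟨t, h⟩ : Fin n) ∈ W
          · exact Or.inl hw
          · right
            cases hu : u ⟨t, h⟩
            · rfl
            · exact absurd ⟨hw, hu⟩ hc
        rw [if_neg hc, readV_eq_zero B rp φ W b h hb, ev_zero]
        simp
    · rw [dif_neg h, crdN, dif_neg h]
      simp


end Near
end JLinPeel
end Summit.QuantumAdvantage.AdviceFreeQNC0
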